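import Mathlib
import Summits.ValiantsHypothesis.ValiantsHypothesis.Theorems.NewtonUnitEquationsDissociatedUniformTotalsLaw
import Summits.ValiantsHypothesis.ValiantsHypothesis.Theorems.NewtonUnitEquationsDissociatedUniformTotalsLawShares
import Summits.ValiantsHypothesis.ValiantsHypothesis.Theorems.NewtonUnitEquationsDissociatedUniformTotalsLawUnion
import Summits.ValiantsHypothesis.ValiantsHypothesis.Theorems.NewtonUnitEquationsDissociatedUniformTotalsLawUnionConverse
import Summits.ValiantsHypothesis.ValiantsHypothesis.Theorems.NewtonUnitEquationsDissociatedUniformTotalsLawChartTops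
import Summits.ValiantsHypothesis.ValiantsHypothesis.Theorems.NewtonUnitEquationsDissociatedUniformTotalsLawChartLevels
import Summits.ValiantsHypothesis.ValiantsHypothesis.Theorems.NewtonUnitEquationsDissociatedUniformTotalsLawChartLevelsTopSets
import Summits.ValiantsHypothesis.ValiantsHypothesis.Theorems.NewtonUnitEquationsDissociatedUniformTotalsLawChartLevelsCount
import Summits.ValiantsHypothesis.ValiantsHypothesis.Theorems.NewtonUnitEquationsDissociatedUniformTotalsLawChartLevelsPairs
import Summits.ValiantsHypothesis.ValiantsHypothesis.Theorems.NewtonUnitEquationsDissociatedUniformTotalsLawFibreDepth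
import Literature.Computability.AlgebraicComplexity.NewtonPolygonTauProductBounds
import HarnessLib

/-!
# Crux `NewtonUnitEquations.DissociatedUniform` (stmt-ValiantsHypothesis-5905): the union-of-fibres totals law on the CO-SMALL stratum

Companion of `…TotalsLawUnion` (`@[conjecture] UnionTotalsLaw C : ∑_s #vert conv U_s(Z) ≤ C·|G|²`, `U_s(Z) = ⋃_{z∈Z} P_{s-z}`).  The law is
trivial for SMALL position sets (`unionTotal ≤ |Z|·|G|²`, `…TotalsLawUnion.unionTotal_le_card_mul`); here the other end: position
sets MISSING only `w = |G| - |Z|` positions.  This is the first consumer of the bricks (R2) (`…TotalsLawFibreDepth`) and (R3)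
(`…ChartLevelsPairs`) of memo `Cruxes/DissociatedUniform/NOTES-t1g4.md` §4, and needs no general position:

* every hull vertex of `U_s(Z)` is a strict top along a chart `(σ, t)`, `σ = ±1`, at a time `t` GENERIC for both alphabets
  (`exists_generic_isStrictTop`: strict tops are stable under perturbation of `t`, tie times are finitely many);
* such a top `a x + b y` has its fibre's above-set inside the `w` MISSING positions (`…FibreDepth.not_mem_of_mem_aboveFibres`), so both
  letters have rank `≤ w` (`…FibreDepth.ranks_le_depth_of_isStrictTop_union`): the vertex is the sum of a SHALLOW PAIR of depth `< w + 1`;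
* shallow pairs are few (`…ChartLevelsPairs.card_shallowPairs_le_linear`).
Hence **`unionVert_le_of_cosmall`**: `#vert conv U_s(Z) ≤ 2 (w+1)² (32 (w+1) |G| + 1)` for EVERY class `s`, and
**`unionTotal_le_of_cosmall`**: `unionTotal a b Z ≤ 2 (w+1)² (32 (w+1)|G| + 1) · |G|` — the union totals law with constant `O(w³)` on
the co-small stratum (both ends `|Z| = O(1)` and `|G ∖ Z| = O(1)` are additive; the middle `|Z| ≍ |G|/2` is the open case, memo (R4));
and, for the `n = 3` law itself, **`totalVert_le_of_const_off`**: a third curve CONSTANT OFF `≤ w` POSITIONS (arbitrary there) has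
`T ≤ (2(w+1)²(32(w+1)|G|+1) + w|G|)·|G|` — the robust form (`w = O(1)`) of the constant stratum `…TotalsLaw.totalVert_const_le`.
Honest label: a stratum of the union law; `UnionTotalsLaw` / `TotalsLawThree` remain OPEN; nothing here bears on VP ≠ VNP.
[folklore]
-/

set_option linter.dupNamespace false -- `ValiantsHypothesis.ValiantsHypothesis` (summit = problem) in every name

open scoped BigOperators

namespace Summit.ValiantsHypothesis.ValiantsHypothesis.Theorems.NewtonUnitEquationsDissociatedUniform

namespace TotalsLaw

open Literature.Computability.AlgebraicComplexity.KPTT.PlanarMinkowski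

/-! ### Generic strict tops -/

/-- The finitely many candidate tie times of a finite planar set along the chart `(σ, ·)`. -/
noncomputable def crossTimes (σ : ℝ) (F : Finset (Fin 2 → ℝ)) : Finset ℝ :=
  ((F ×ˢ F).filter fun pq => pq.1 1 ≠ pq.2 1).image fun pq => crossT σ pq.1 pq.2

/-- Off the candidate tie times every time is generic (`σ ≠ 0`). [folklore] -/
theorem generic_of_not_mem_crossTimes {σ : ℝ} (hσ : σ ≠ 0) (F : Finset (Fin 2 → ℝ)) {t : ℝ}
    (ht : t ∉ crossTimes σ F) : Generic σ F t := by
  intro p hp q hq hpq heq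
  apply ht
  have hs : p 1 ≠ q 1 := slope_ne_of_chart_eq hσ hpq heq
  unfold crossTimes
  rw [Finset.mem_image]
  exact ⟨(p, q), Finset.mem_filter.2 ⟨Finset.mem_product.2 ⟨hp, hq⟩, hs⟩, (eq_crossT_of_chart_eq σ hs heq).symm⟩

/-- **Generic exposure.**  A hull vertex of a finite planar set `U` is a strict top along a chart `(σ, t)`, `σ = ±1`, at a time
`t` generic for any two given finite sets `A`, `B` (perturb the exposing time off the finitely many tie times). [folklore] -/
theorem exists_generic_isStrictTop (U A B : Finset (Fin 2 → ℝ)) {p : Fin 2 → ℝ}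
    (hp : p ∈ (convexHull ℝ (U : Set (Fin 2 → ℝ))).extremePoints ℝ) :
    ∃ σ t : ℝ, (σ = 1 ∨ σ = -1) ∧ Generic σ A t ∧ Generic σ B t ∧ IsStrictTop ![σ, t] U p := by
  classical
  -- a chart exposing `p`
  have hchart : ∃ σ t₀ : ℝ, (σ = 1 ∨ σ = -1) ∧ IsStrictTop ![σ, t₀] U p := by
    rcases mem_extremePoints_iff_charts.1 hp with ⟨t₀, h⟩ | ⟨t₀, h⟩
    · exact ⟨1, t₀, Or.inl rfl, h⟩
    · exact ⟨-1, t₀, Or.inr rfl, h⟩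
  obtain ⟨σ, t₀, hσ, htop⟩ := hchart
  have hσ0 : σ ≠ 0 := by rcases hσ with rfl | rfl <;> norm_num
  obtain ⟨ε, hε, hstable⟩ := htop.exists_perturb_chart
  -- a generic time in the stability window
  have hinf : (Set.Ioo (t₀ - ε) (t₀ + ε)).Infinite := Set.Ioo_infinite (by linarith)
  obtain ⟨t, ht, htS⟩ := hinf.exists_notMem_finset (crossTimes σ A ∪ crossTimes σ B)
  rw [Finset.mem_union, not_or] at htS
  refine ⟨σ, t, hσ, generic_of_not_mem_crossTimes hσ0 A htS.1, generic_of_not_mem_crossTimes hσ0 B htS.2, hstable t ?_⟩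
  rw [Set.mem_Ioo] at ht
  rw [abs_le]
  constructor <;> linarith

/-! ### The co-small stratum -/

variable {G : Type*} [AddCommGroup G] [Fintype G]

/-- In a union over the position set `Z`, the above-set of the fibre of a strict top lies inside the MISSING positions, so its size
is at most `|G| - |Z|`. [folklore] -/
theorem card_aboveFibres_le_of_isStrictTop (a b : G → (Fin 2 → ℝ)) (Z : Finset G) {σ t : ℝ} {s r x : G}
    (htop : IsStrictTop ![σ, t] (unionFin a b (Z : Set G) s) (a x + b (r - x))) :
    (aboveFibres a b σ t r).card ≤ Fintype.card G - Z.card := by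
  classical
  -- the above-set avoids the translate `s - Z`
  have hsub : aboveFibres a b σ t r ⊆ Finset.univ.filter fun r' : G => s - r' ∉ Z := by
    intro r' hr'
    exact Finset.mem_filter.2 ⟨Finset.mem_univ _, not_mem_of_mem_aboveFibres a b (Z : Set G) htop hr'⟩
  -- the translate `{r' : s - r' ∈ Z}` has `|Z|` elements
  have hcard : (Finset.univ.filter fun r' : G => s - r' ∈ Z).card = Z.card := by
    refine Finset.card_bij (fun r' _ => s - r') (fun r' hr' => (Finset.mem_filter.1 hr').2) ?_ ?_
    · intro r₁ _ r₂ _ h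
      exact sub_right_injective h
    · intro z hz
      exact ⟨s - z, Finset.mem_filter.2 ⟨Finset.mem_univ _, by rw [sub_sub_cancel]; exact hz⟩, sub_sub_cancel s z⟩
  have hcompl : (Finset.univ.filter fun r' : G => s - r' ∉ Z).card = Fintype.card G - Z.card := by
    have h := Finset.card_filter_add_card_filter_not (s := (Finset.univ : Finset G)) (fun r' : G => s - r' ∈ Z)
    rw [hcard, Finset.card_univ] at h
    omega
  calc (aboveFibres a b σ t r).card ≤ (Finset.univ.filter fun r' : G => s - r' ∉ Z).card := Finset.card_le_card hsub
    _ = Fintype.card G - Z.card := hcompl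

/-- **Vertices of a co-small union are sums of shallow pairs.**  With `w = |G| - |Z|`, every hull vertex of `U_s(Z)` is `q₁ + q₂`
for a shallow pair `(q₁, q₂) ∈ shallowPairs σ a(G) b(G) (w + 1)` along one of the two charts `σ = ±1`. [folklore] -/
theorem extremePoints_union_subset_shallowPairs (a b : G → (Fin 2 → ℝ)) (Z : Finset G) (s : G)
    [DecidableEq (Fin 2 → ℝ)] :
    (convexHull ℝ (unionPts a b (Z : Set G) s)).extremePoints ℝ ⊆
      (((shallowPairs 1 (Finset.univ.image a) (Finset.univ.image b) (Fintype.card G - Z.card + 1)).image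
          fun qq => qq.1 + qq.2 : Finset (Fin 2 → ℝ)) : Set (Fin 2 → ℝ)) ∪
      (((shallowPairs (-1) (Finset.univ.image a) (Finset.univ.image b) (Fintype.card G - Z.card + 1)).image
          fun qq => qq.1 + qq.2 : Finset (Fin 2 → ℝ)) : Set (Fin 2 → ℝ)) := by
  classical
  intro p hp
  set A := (Finset.univ.image a : Finset (Fin 2 → ℝ)) with hAdef
  set B := (Finset.univ.image b : Finset (Fin 2 → ℝ)) with hBdef
  have hA : (A : Set (Fin 2 → ℝ)) = Set.range a := by rw [hAdef, Finset.coe_image, Finset.coe_univ, Set.image_univ]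
  have hB : (B : Set (Fin 2 → ℝ)) = Set.range b := by rw [hBdef, Finset.coe_image, Finset.coe_univ, Set.image_univ]
  rw [← coe_unionFin a b (Z : Set G) s] at hp
  obtain ⟨σ, t, hσ, hgA, hgB, htop⟩ := exists_generic_isStrictTop (unionFin a b (Z : Set G) s) A B hp
  -- the vertex as a pair of letters in a present fibre
  have hpU : p ∈ unionPts a b (Z : Set G) s := by
    rw [← coe_unionFin a b (Z : Set G) s]
    exact htop.mem
  obtain ⟨x, y, hxy, rfl⟩ := mem_unionPts.1 hpU
  have hyr : y = (x + y) - x := by abel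
  have htop' : IsStrictTop ![σ, t] (unionFin a b (Z : Set G) s) (a x + b ((x + y) - x)) := by rw [← hyr]; exact htop
  have hr : s - (x + y) ∈ (Z : Set G) := by rw [show s - (x + y) = s - x - y by abel]; exact hxy
  obtain ⟨h1, h2⟩ := ranks_le_depth_of_isStrictTop_union a b (Z : Set G) hr htop' A B hA hB
  rw [← hyr] at h2
  have hd := card_aboveFibres_le_of_isStrictTop a b Z htop'
  have hmem : (a x, b y) ∈ shallowPairs σ A B (Fintype.card G - Z.card + 1) := by
    unfold shallowPairs
    refine Finset.mem_filter.2 ⟨Finset.mem_product.2 ⟨?_, ?_⟩, t, hgA, hgB, by simp only; omega, by simp only; omega⟩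
    · exact Finset.mem_image.2 ⟨x, Finset.mem_univ _, rfl⟩
    · exact Finset.mem_image.2 ⟨y, Finset.mem_univ _, rfl⟩
  rcases hσ with rfl | rfl
  · left
    rw [Finset.coe_image]
    exact ⟨(a x, b y), Finset.mem_coe.2 hmem, rfl⟩
  · right
    rw [Finset.coe_image]
    exact ⟨(a x, b y), Finset.mem_coe.2 hmem, rfl⟩

/-- **The union totals law on the co-small stratum, per class.**  With `w = |G| - |Z|`:
`#vert conv U_s(Z) ≤ 2 (w+1)² (32 (w+1) |G| + 1)` for every class `s`. [folklore] -/
theorem unionVert_le_of_cosmall (a b : G → (Fin 2 → ℝ)) (Z : Finset G) (s : G) :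
    unionVert a b (Z : Set G) s ≤
      2 * ((Fintype.card G - Z.card + 1) * (Fintype.card G - Z.card + 1) *
        (32 * (Fintype.card G - Z.card + 1) * Fintype.card G + 1)) := by
  classical
  set w1 := Fintype.card G - Z.card + 1 with hw1
  set A := (Finset.univ.image a : Finset (Fin 2 → ℝ)) with hAdef
  set B := (Finset.univ.image b : Finset (Fin 2 → ℝ)) with hBdef
  have hAc : A.card ≤ Fintype.card G := Finset.card_image_le.trans (by rw [Finset.card_univ])
  have hBc : B.card ≤ Fintype.card G := Finset.card_image_le.trans (by rw [Finset.card_univ])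
  have hw1pos : 1 ≤ w1 := by omega
  have hbound : ∀ σ : ℝ, σ ≠ 0 → (shallowPairs σ A B w1).card ≤ w1 * w1 * (32 * w1 * Fintype.card G + 1) := by
    intro σ hσ
    calc (shallowPairs σ A B w1).card ≤ w1 * w1 * (16 * w1 * (A.card + B.card) + 1) := card_shallowPairs_le_linear hσ A B hw1pos
      _ ≤ w1 * w1 * (16 * w1 * (Fintype.card G + Fintype.card G) + 1) := by gcongr
      _ = w1 * w1 * (32 * w1 * Fintype.card G + 1) := by ring
  have hsub := extremePoints_union_subset_shallowPairs a b Z s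
  unfold unionVert
  calc ((convexHull ℝ (unionPts a b (Z : Set G) s)).extremePoints ℝ).ncard
      ≤ ((((shallowPairs 1 A B w1).image fun qq => qq.1 + qq.2 : Finset (Fin 2 → ℝ)) : Set (Fin 2 → ℝ)) ∪
          (((shallowPairs (-1) A B w1).image fun qq => qq.1 + qq.2 : Finset (Fin 2 → ℝ)) : Set (Fin 2 → ℝ))).ncard :=
        Set.ncard_le_ncard hsub ((Finset.finite_toSet _).union (Finset.finite_toSet _))
    _ ≤ (((shallowPairs 1 A B w1).image fun qq => qq.1 + qq.2 : Finset (Fin 2 → ℝ)) : Set (Fin 2 → ℝ)).ncard +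
          (((shallowPairs (-1) A B w1).image fun qq => qq.1 + qq.2 : Finset (Fin 2 → ℝ)) : Set (Fin 2 → ℝ)).ncard :=
        Set.ncard_union_le _ _
    _ = ((shallowPairs 1 A B w1).image fun qq => qq.1 + qq.2).card +
          ((shallowPairs (-1) A B w1).image fun qq => qq.1 + qq.2).card := by
        rw [Set.ncard_coe_finset, Set.ncard_coe_finset]
    _ ≤ (shallowPairs 1 A B w1).card + (shallowPairs (-1) A B w1).card :=
        add_le_add Finset.card_image_le Finset.card_image_le
    _ ≤ w1 * w1 * (32 * w1 * Fintype.card G + 1) + w1 * w1 * (32 * w1 * Fintype.card G + 1) :=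
        add_le_add (hbound 1 one_ne_zero) (hbound (-1) (by norm_num))
    _ = 2 * (w1 * w1 * (32 * w1 * Fintype.card G + 1)) := by ring

/-- **The union totals law on the co-small stratum.**  With `w = |G| - |Z|`:
`unionTotal a b Z ≤ 2 (w+1)² (32 (w+1) |G| + 1) · |G|` — constant `O(w³)`, so position sets missing boundedly many positions are
additive (as are boundedly small ones, `unionTotal_le_card_mul`). [folklore] -/
theorem unionTotal_le_of_cosmall (a b : G → (Fin 2 → ℝ)) (Z : Finset G) :
    unionTotal a b (Z : Set G) ≤
      2 * ((Fintype.card G - Z.card + 1) * (Fintype.card G - Z.card + 1) *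
        (32 * (Fintype.card G - Z.card + 1) * Fintype.card G + 1)) * Fintype.card G := by
  unfold unionTotal
  calc ∑ s, unionVert a b (Z : Set G) s
      ≤ ∑ _s : G, 2 * ((Fintype.card G - Z.card + 1) * (Fintype.card G - Z.card + 1) *
          (32 * (Fintype.card G - Z.card + 1) * Fintype.card G + 1)) :=
        Finset.sum_le_sum fun s _ => unionVert_le_of_cosmall a b Z s
    _ = _ := by rw [Finset.sum_const, Finset.card_univ, smul_eq_mul, mul_comm]


/-! ### Third curves constant off `w` positions -/

/-- The bound of the co-small stratum is monotone in the number of missing positions. [folklore] -/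
theorem cosmallBound_mono {q w w' : ℕ} (h : w' ≤ w) :
    2 * ((w' + 1) * (w' + 1) * (32 * (w' + 1) * q + 1)) ≤ 2 * ((w + 1) * (w + 1) * (32 * (w + 1) * q + 1)) := by
  gcongr

/-- **Third curves constant off few positions are additive.**  If `c z = v₀` at all but at most `w` positions (arbitrary values
there), then every class satisfies `V_s ≤ 2 (w+1)² (32 (w+1) |G| + 1) + w |G|`: the level-set decomposition
(`…TotalsLawUnion.classVert_le_sum_unionVert`) splits the class into the co-small union over `{c = v₀}` and unions over position sets of
total size `≤ w`.  (`w = 0` is the constant stratum of `…TotalsLaw.totalVert_const_le`.) [folklore] -/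
theorem classVert_le_of_const_off (a b c : G → (Fin 2 → ℝ)) (v₀ : Fin 2 → ℝ) {w : ℕ} [DecidableEq (Fin 2 → ℝ)]
    (hw : (Finset.univ.filter fun z : G => c z ≠ v₀).card ≤ w) (s : G) :
    classVert a b c s ≤ 2 * ((w + 1) * (w + 1) * (32 * (w + 1) * Fintype.card G + 1)) + w * Fintype.card G := by
  classical
  set Z₀ : Finset G := Finset.univ.filter fun z : G => c z = v₀ with hZ₀
  set Z₁ : Finset G := Finset.univ.filter fun z : G => c z ≠ v₀ with hZ₁
  have hpre : ∀ v, c ⁻¹' {v} = ((Finset.univ.filter fun z : G => c z = v : Finset G) : Set G) := by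
    intro v; ext z; simp
  have hZ₀card : Fintype.card G - Z₀.card ≤ w := by
    have hZ₁eq : Z₁ = Finset.univ \ Z₀ := by
      ext z
      simp [hZ₀, hZ₁]
    have h : Z₁.card = Fintype.card G - Z₀.card := by
      rw [hZ₁eq, Finset.card_sdiff_of_subset (Finset.subset_univ _), Finset.card_univ]
    rw [← h]
    exact hw
  -- the co-small part
  have h₀ : unionVert a b (c ⁻¹' {v₀}) s ≤ 2 * ((w + 1) * (w + 1) * (32 * (w + 1) * Fintype.card G + 1)) := by
    rw [hpre v₀]
    exact (unionVert_le_of_cosmall a b Z₀ s).trans (cosmallBound_mono hZ₀card)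
  -- the exceptional parts
  have h₁ : ∑ v ∈ (Finset.univ.image c).erase v₀, unionVert a b (c ⁻¹' {v}) s ≤ w * Fintype.card G := by
    have hfib : Z₁.card = ∑ v ∈ (Finset.univ.image c).erase v₀, (Z₁.filter fun z => c z = v).card :=
      Finset.card_eq_sum_card_fiberwise fun z hz =>
        Finset.mem_erase.2 ⟨(Finset.mem_filter.1 hz).2, Finset.mem_image.2 ⟨z, Finset.mem_univ _, rfl⟩⟩
    have hfil : ∀ v ∈ (Finset.univ.image c).erase v₀, (Z₁.filter fun z => c z = v) = Finset.univ.filter fun z : G => c z = v := by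
      intro v hv
      have hv₀ : v ≠ v₀ := (Finset.mem_erase.1 hv).1
      ext z
      simp only [hZ₁, Finset.mem_filter, Finset.mem_univ, true_and]
      constructor
      · exact fun h => h.2
      · intro h
        exact ⟨by rw [h]; exact hv₀, h⟩
    calc ∑ v ∈ (Finset.univ.image c).erase v₀, unionVert a b (c ⁻¹' {v}) s
        ≤ ∑ v ∈ (Finset.univ.image c).erase v₀, (Finset.univ.filter fun z : G => c z = v).card * Fintype.card G :=
          Finset.sum_le_sum fun v _ => by
            rw [hpre v]
            exact unionVert_le_card_mul a b _ s
      _ = (∑ v ∈ (Finset.univ.image c).erase v₀, (Z₁.filter fun z => c z = v).card) * Fintype.card G := by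
          rw [Finset.sum_mul]
          exact Finset.sum_congr rfl fun v hv => by rw [hfil v hv]
      _ = Z₁.card * Fintype.card G := by rw [← hfib]
      _ ≤ w * Fintype.card G := Nat.mul_le_mul_right _ hw
  -- assemble
  by_cases hv₀ : v₀ ∈ Finset.univ.image c
  · calc classVert a b c s ≤ ∑ v ∈ Finset.univ.image c, unionVert a b (c ⁻¹' {v}) s := classVert_le_sum_unionVert a b c s
      _ = unionVert a b (c ⁻¹' {v₀}) s + ∑ v ∈ (Finset.univ.image c).erase v₀, unionVert a b (c ⁻¹' {v}) s :=
          (Finset.add_sum_erase _ _ hv₀).symm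
      _ ≤ _ := add_le_add h₀ h₁
  · -- `v₀` is never taken: every position is exceptional, `|G| ≤ w`
    have hall : Z₁ = Finset.univ := by
      refine Finset.eq_univ_of_forall fun z => Finset.mem_filter.2 ⟨Finset.mem_univ _, fun h => hv₀ ?_⟩
      exact Finset.mem_image.2 ⟨z, Finset.mem_univ _, h⟩
    have hq : Fintype.card G ≤ w := by rw [← Finset.card_univ, ← hall]; exact hw
    calc classVert a b c s ≤ Fintype.card G ^ 2 := classVert_le_card_sq a b c s
      _ = Fintype.card G * Fintype.card G := sq _
      _ ≤ w * Fintype.card G := Nat.mul_le_mul_right _ hq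
      _ ≤ _ := Nat.le_add_left _ _

/-- **`T ≤ (2 (w+1)² (32 (w+1)|G| + 1) + w|G|) · |G|`** for third curves constant off at most `w` positions — the `n = 3` totals law
with constant `O(w³)` on this stratum (`w = 0`: the constant third curve). [folklore] -/
theorem totalVert_le_of_const_off (a b c : G → (Fin 2 → ℝ)) (v₀ : Fin 2 → ℝ) {w : ℕ} [DecidableEq (Fin 2 → ℝ)]
    (hw : (Finset.univ.filter fun z : G => c z ≠ v₀).card ≤ w) :
    totalVert a b c ≤ (2 * ((w + 1) * (w + 1) * (32 * (w + 1) * Fintype.card G + 1)) + w * Fintype.card G) * Fintype.card G := by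
  unfold totalVert
  calc ∑ s, classVert a b c s ≤ ∑ _s : G, (2 * ((w + 1) * (w + 1) * (32 * (w + 1) * Fintype.card G + 1)) + w * Fintype.card G) :=
        Finset.sum_le_sum fun s _ => classVert_le_of_const_off a b c v₀ hw s
    _ = _ := by rw [Finset.sum_const, Finset.card_univ, smul_eq_mul, mul_comm]

end TotalsLaw

end Summit.ValiantsHypothesis.ValiantsHypothesis.Theorems.NewtonUnitEquationsDissociatedUniform
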